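import Literature.NumberTheory.LFunctions.WeilWindowSimpleEven
import Literature.NumberTheory.LFunctions.WeilExplicitProofs

/-!
# Stub `stub_archPolarAdd` for crux SignConeDuality (line Sketch, item stmt-RiemannHypothesis-16304)

Additivity of the prime-free Weil form `W_ar F := weilPolarTerm F + weilArchTerm F` on Weil test
kernels: both the polar term (`weilMellin_add`) and the archimedean integral
(`weilArchIntegral_add`) are additive under the continuity / compact-support hypotheses packaged
in `IsWeilTest`. Support lemma; it does not close the item.
-/

noncomputable section

open scoped BigOperators ComplexConjugate
open Complex MeasureTheory Set

namespace Summit.RiemannHypothesis.RiemannHypothesis.Theorems.SignConeDuality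

open Literature.NumberTheory.LFunctions

-- adapted from Cruxes/SignConeDuality/SketchIdeator1Transport.lean (`archPolar_add'`)
/-- **Additivity of the prime-free Weil form on test kernels**:
`W_ar(F₁ + F₂) = W_ar(F₁) + W_ar(F₂)` for `W_ar F := weilPolarTerm F + weilArchTerm F`, whenever
`F₁, F₂` are Weil test functions (smooth, compactly supported). The polar term is additive by
`weilMellin_add`, the archimedean integral by `weilArchIntegral_add`, and `F ↦ F 0 · log π` is
linear. [folklore] -/
theorem stub_archPolarAdd : ∀ F₁ F₂ : ℝ → ℂ, IsWeilTest F₁ → IsWeilTest F₂ →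
    weilPolarTerm (F₁ + F₂) + weilArchTerm (F₁ + F₂) =
      (weilPolarTerm F₁ + weilArchTerm F₁) + (weilPolarTerm F₂ + weilArchTerm F₂) := by
  intro F₁ F₂ h₁ h₂
  simp only [weilPolarTerm, weilArchTerm, weilArchIntegral_add h₁ h₂,
    weilMellin_add h₁.1.continuous h₁.2 h₂.1.continuous h₂.2, Pi.add_apply]
  ring

end Summit.RiemannHypothesis.RiemannHypothesis.Theorems.SignConeDuality

end
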